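import Summits.QuantumAdvantage.QuantumAdvantage.Theorems.CubicForrelationNearExactIsExactSecondWeight

/-!
# Crux `CubicForrelation.NearExactIsExact` (stmt-QuantumAdvantage-14043) — n = 12: E1280 is LOCAL — only the directions of slice rank
  2 and 4 of the matching dual matter

Certificate seat `b2b-cforr-cert` (gen 34).  HONEST FRAMING: a kernel-checked elementary counting lemma (standard axioms) about Boolean
functions on 12 bits.  It closes nothing by itself and is NOT summit progress; it records the exact (and much smaller) shape of what the
remaining paper statement "E1280-even" of the open window `(57/64, 29/32)` of the 12-bit cubic-Forrelation slice must deliver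
(HOME/b2b-cforr-cert-g34/PLAN-N12-LOWRANK.md; predecessor: …TwelveDigitProfile, …TwelveDigitE1280Frame, PLAN-N12-E1280.md §6).

* `tdlr_weight_window_of_low_rank` (**low-rank localisation**): let `κ` be any Boolean function on 12 bits, `e = #{κ = 1}`, and let
  `S₂`, `S₄` be two sets of directions such that the derivative `D_aκ = κ ⊕ κ(· ⊕ a)` has at least `1024` ones for `a ∈ S₂`, at least
  `1536` ones for `a ∈ S₄`, and at least `1792` ones for every other `a ≠ 0`.  If `3·#S₂ + #S₄ ≤ 601` then `1273 ≤ e ≤ 2823`.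
  (Double counting `Σ_a #D_aκ = 2e(4096 − e)`, `sw_sum_deriv_card`; the margin is `64`: `1272·2824 = 3592128 < 3592192`.)
* `tdlr_e_ge_1280_of_low_rank`: with `8 ∣ e` (a cubic support on 12 bits) this gives `e ≥ 1280`.

USE (paper).  For the digit class `κ = [W_g/16 ≡ ±1 (mod 8)]` of a type-O cubic `g` on 12 bits, `D_aκ` is a quadratic whose alternating
form is the slice `ι_a C*` of the MATCHING DUAL `C*` of the cubic 3-graph `C` of `g` (…TwelveDigitDualForm); a quadratic of symplectic
rank `2h` has `#ones ≥ 2048 − 2^{11−h}` (…TwelveDigitProfile, `tdq_frame_card`), i.e. `≥ 1024 / 1536 / 1792` for rank `2 / 4 / ≥ 6`.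
Hence the hypotheses hold with `S₂ = {a : rank ι_a C* = 2}`, `S₄ = {a : rank ι_a C* = 4}` (and even with the smaller sets of UNBALANCED
such directions), so

  `E1280 (e ≥ 1280 for every type-O cubic on 12 bits, hence θ₁₂ = 57/64 by …TwelveDigitWeightReduction)  ⟸  3·N₂(C*) + N₄(C*) ≤ 601`,

`N_{2r}(C*) := #{a ≠ 0 : rank ι_a C* = 2r}`, for the matching dual of every type-O 3-graph `C` with `#PM(C*)` even (the odd case is
THEOREM W, …TwelveOddWeight).  This replaces CONJECTURE P of PLAN-N12-E1280 §6 (a bound on the whole slice-rank profile,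
`Σ_{a≠0} 2^{11−rank/2} ≤ 1202303`) by a statement about the two lowest ranks only; equivalently (PLAN-N12-LOWRANK §2) about hyperplanes
`Z = ker a` of `𝔽₂¹²` whose restricted cubic `c|_Z` has its 3-matchings concentrated on the complements of one 2-plane (rank 2) or of
one 4-space (rank 4).  Numerically (kit job j212619, 4 399 931 random type-O `C` in 11 ensembles; HOME/code/cert-g34): the odd-`#PM(C*)`
duals never exceed the profile of four disjoint monomials — `N₂ ≤ 28`, `N₄ ≤ 294`, `3N₂ + N₄ ≤ 378` (and `N₂ ≤ 28` is a theorem for them: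
a type-O cubic form on `3k` variables has at most `7k` slices of rank 2, PLAN-N12-LOWRANK §3); over the 651 069 even-`#PM(C*)` duals —
the only case still open — the maximum is `3N₂ + N₄ = 99` (`N₂ ≤ 9`, `N₄ ≤ 77`).  The bound `601` is what this lemma needs.

References: F. J. MacWilliams, N. J. A. Sloane, *The Theory of Error-Correcting Codes* (1977) Ch. 15 (quadratic forms over 𝔽₂);
C. Carlet, *Boolean Functions for Cryptography and Coding Theory* (2021) §2.2.  Axioms: the standard three.
-/

set_option linter.dupNamespace false -- D-0017: single-problem summit ⇒ `QuantumAdvantage.QuantumAdvantage` by design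

noncomputable section

namespace Summit.QuantumAdvantage.QuantumAdvantage.Theorems.CubicForrelation.NearExactIsExact

open Finset
open Literature.Computability.QuantumComplexity
open Literature.Computability.QuantumComplexity.BuzetChailloux (bxor zeroVec bxor_zeroVec)

section LowRank

/-- **Low-rank localisation of the profile bound.**  For any Boolean `κ` on 12 bits with `e = #{κ = 1}`: if the derivative
`D_aκ` has `≥ 1024` ones for `a ∈ S₂`, `≥ 1536` ones for `a ∈ S₄`, `≥ 1792` ones for all other `a ≠ 0`, and `3·#S₂ + #S₄ ≤ 601`,
then `1273 ≤ e ≤ 2823`.  (For the digit class of a type-O cubic: `S₂`, `S₄` = directions of slice rank `2`, `4` of the matching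
dual, by `tdq_frame_card`.) [this work] -/
theorem tdlr_weight_window_of_low_rank (κ : (Fin (6 + 6) → Bool) → Bool) (S₂ S₄ : Finset (Fin (6 + 6) → Bool))
    (h2 : ∀ a ∈ S₂, 1024 ≤ #(univ.filter fun x : Fin (6 + 6) → Bool => (κ x ^^ κ (bxor x a)) = true))
    (h4 : ∀ a ∈ S₄, 1536 ≤ #(univ.filter fun x : Fin (6 + 6) → Bool => (κ x ^^ κ (bxor x a)) = true))
    (h6 : ∀ a : Fin (6 + 6) → Bool, a ≠ zeroVec → a ∉ S₂ → a ∉ S₄ →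
      1792 ≤ #(univ.filter fun x : Fin (6 + 6) → Bool => (κ x ^^ κ (bxor x a)) = true))
    (hS : 3 * #S₂ + #S₄ ≤ 601) :
    1273 ≤ #(univ.filter fun x : Fin (6 + 6) → Bool => κ x = true) ∧
      #(univ.filter fun x : Fin (6 + 6) → Bool => κ x = true) ≤ 2823 := by
  classical
  set e := #(univ.filter fun x : Fin (6 + 6) → Bool => κ x = true) with he
  set δ : (Fin (6 + 6) → Bool) → ℕ :=
    fun a => #(univ.filter fun x : Fin (6 + 6) → Bool => (κ x ^^ κ (bxor x a)) = true) with hδ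
  set T : Finset (Fin (6 + 6) → Bool) := univ.erase zeroVec with hT
  -- cardinalities
  have hU : #(univ : Finset (Fin (6 + 6) → Bool)) = 4096 := by
    rw [card_univ, Fintype.card_fun, Fintype.card_bool, Fintype.card_fin]; norm_num
  have hTcard : #T = 4095 := by
    rw [hT, card_erase_of_mem (mem_univ _), hU]
  have hle : e ≤ 4096 := (card_le_univ _).trans_eq hU
  -- the double count `Σ_a δ a = 2 e (4096 - e)` restricted to `a ≠ 0` (`δ 0 = 0`)
  have hsum := sw_sum_deriv_card κ
  have h12 : (2 : ℕ) ^ (6 + 6) = 4096 := by norm_num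
  rw [h12] at hsum
  have h0 : δ zeroVec = 0 := by
    rw [hδ]; simp only
    rw [card_eq_zero, filter_eq_empty_iff]
    intro x _
    rw [bxor_zeroVec, Bool.xor_self]
    exact Bool.false_ne_true
  have hsplit := sum_erase_add (s := (univ : Finset (Fin (6 + 6) → Bool))) (a := zeroVec) (f := fun a => (δ a : ℕ))
    (mem_univ _)
  rw [h0, add_zero] at hsplit
  have hsumT : ∑ a ∈ T, (δ a : ℤ) = 2 * (e : ℤ) * (4096 - (e : ℤ)) := by
    have h1 : ((∑ a ∈ T, δ a : ℕ) : ℤ) = ((2 * e * (4096 - e) : ℕ) : ℤ) := by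
      rw [hT, hsplit]; exact_mod_cast hsum
    push_cast [Nat.cast_sub hle] at h1
    exact h1
  -- pointwise lower bound on `T`
  have hpt : ∀ a ∈ T,
      (1792 : ℤ) - 768 * (if a ∈ S₂ then (1 : ℤ) else 0) - 256 * (if a ∈ S₄ then (1 : ℤ) else 0) ≤ (δ a : ℤ) := by
    intro a ha
    have ha0 : a ≠ zeroVec := ne_of_mem_erase ha
    by_cases h2a : a ∈ S₂
    · have h' : (1024 : ℤ) ≤ δ a := by exact_mod_cast h2 a h2a
      rw [if_pos h2a]
      split_ifs <;> linarith
    · by_cases h4a : a ∈ S₄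
      · have h' : (1536 : ℤ) ≤ δ a := by exact_mod_cast h4 a h4a
        rw [if_neg h2a, if_pos h4a]; linarith
      · have h' : (1792 : ℤ) ≤ δ a := by exact_mod_cast h6 a ha0 h2a h4a
        rw [if_neg h2a, if_neg h4a]; linarith
  have hlow := sum_le_sum hpt
  -- evaluate the left-hand side
  have hind2 : ∑ a ∈ T, (if a ∈ S₂ then (1 : ℤ) else 0) ≤ #S₂ := by
    rw [sum_boole, filter_mem_eq_inter]
    exact_mod_cast card_le_card inter_subset_right
  have hind4 : ∑ a ∈ T, (if a ∈ S₄ then (1 : ℤ) else 0) ≤ #S₄ := by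
    rw [sum_boole, filter_mem_eq_inter]
    exact_mod_cast card_le_card inter_subset_right
  have hlhs : ∑ a ∈ T, ((1792 : ℤ) - 768 * (if a ∈ S₂ then (1 : ℤ) else 0) - 256 * (if a ∈ S₄ then (1 : ℤ) else 0)) =
      1792 * 4095 - 768 * ∑ a ∈ T, (if a ∈ S₂ then (1 : ℤ) else 0) - 256 * ∑ a ∈ T, (if a ∈ S₄ then (1 : ℤ) else 0) := by
    rw [sum_sub_distrib, sum_sub_distrib, sum_const, hTcard, ← mul_sum, ← mul_sum]
    simp
  rw [hlhs, hsumT] at hlow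
  have hS' : 3 * (#S₂ : ℤ) + (#S₄ : ℤ) ≤ 601 := by exact_mod_cast hS
  -- `2 e (4096 - e) ≥ 1792·4095 − 256·601 = 7184384`, i.e. `e (4096 − e) ≥ 3592192 > 1272·2824`
  have hkey : (3592192 : ℤ) ≤ (e : ℤ) * (4096 - (e : ℤ)) := by linarith
  constructor
  · by_contra hlt
    rw [not_le] at hlt
    have hlt' : (e : ℤ) ≤ 1272 := by exact_mod_cast Nat.lt_succ_iff.1 hlt
    have hnn : (0 : ℤ) ≤ (1272 - (e : ℤ)) * (2824 - (e : ℤ)) := mul_nonneg (by linarith) (by linarith)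
    nlinarith
  · by_contra hgt
    rw [not_le] at hgt
    have hgt' : (2824 : ℤ) ≤ (e : ℤ) := by exact_mod_cast hgt
    have hnn : (0 : ℤ) ≤ ((e : ℤ) - 2824) * ((e : ℤ) - 1272) := mul_nonneg (by linarith) (by linarith)
    nlinarith

/-- **E1280 from the two lowest slice ranks.**  Under the hypotheses of `tdlr_weight_window_of_low_rank`, a support of size divisible
by `8` (e.g. the support of a cubic on 12 bits) has `e ≥ 1280`. [this work] -/
theorem tdlr_e_ge_1280_of_low_rank (κ : (Fin (6 + 6) → Bool) → Bool) (S₂ S₄ : Finset (Fin (6 + 6) → Bool))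
    (h2 : ∀ a ∈ S₂, 1024 ≤ #(univ.filter fun x : Fin (6 + 6) → Bool => (κ x ^^ κ (bxor x a)) = true))
    (h4 : ∀ a ∈ S₄, 1536 ≤ #(univ.filter fun x : Fin (6 + 6) → Bool => (κ x ^^ κ (bxor x a)) = true))
    (h6 : ∀ a : Fin (6 + 6) → Bool, a ≠ zeroVec → a ∉ S₂ → a ∉ S₄ →
      1792 ≤ #(univ.filter fun x : Fin (6 + 6) → Bool => (κ x ^^ κ (bxor x a)) = true))
    (hS : 3 * #S₂ + #S₄ ≤ 601)
    (h8 : 8 ∣ #(univ.filter fun x : Fin (6 + 6) → Bool => κ x = true)) :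
    1280 ≤ #(univ.filter fun x : Fin (6 + 6) → Bool => κ x = true) := by
  have h := (tdlr_weight_window_of_low_rank κ S₂ S₄ h2 h4 h6 hS).1
  omega

end LowRank

end Summit.QuantumAdvantage.QuantumAdvantage.Theorems.CubicForrelation.NearExactIsExact

end
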